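import Literature.Computability.QuantumComplexity.SimonOracleFourier
import Literature.Computability.QuantumComplexity.SimonOracleSegment
import Literature.Computability.QuantumComplexity.SimonOracleLayout
import Mathlib.Algebra.BigOperators.Fin
import HarnessLib

/-!
# The `BQP^O` Simon machine for the level encoding, II: the sampler circuit and its amplitudes

Fourth file of the machine behind the hypothesis `SimonLevelMachine` of
`Literature/Barriers/QuantumAdvantage/PPolyOraclesThm76Simon.lean`. At input length `n`, with
block-length bound `B'` and `M` runs per candidate block length, the **Simon sampler** is the
Clifford+T circuit with XOR oracle gates on `W n B' M` wires (layout of `SimonOracleLayout.lean`)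

  `pre` (set the constant wires; query every announcement string `ancStr n i`, `i ≤ B'`, into its
  answer wire) `;` `H` on all `y`-registers `;` `mid` (copy `y ↦ y'`; query every value string
  `qryStr n y_β i'`, `i' < len β`, into the value wire `w_{β,i'}`; uncopy) `;` `H` on all `y`-registers,

i.e. `NB = B'·M` independent runs of Simon's subroutine Fourier-twice (Simon 1997, §3.1), block
`β` for the candidate block length `len β = β / M + 1`. This file builds the programs and the
circuit (`samplerGates`) and proves their well-formedness; the amplitudes follow in the sequel
from `SimonOracleFourier.sandwich_value_apply` and the `coEval` calculus of `SimonOracleSegment.lean`.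

## References

* D. R. Simon, SIAM J. Comput. 26 (1997), §3.1 [Simon1997].
* R. Servedio, S. Gortler, SIAM J. Comput. 33 (2004), §6 [ServedioGortler2004].
* M. A. Nielsen, I. L. Chuang, CUP 2010, §1.4.4, §6.1.1 [NielsenChuang2010].
-/

noncomputable section

namespace Literature.Computability.QuantumComplexity

open Matrix _root_.Computability Complexity Cryptography Finset RevSim RazTalMachine

namespace SimonOracle

/-! ### Parameters, blocks, wires -/

section Params

variable (n B' M : ℕ)

/-- The number of blocks: `M` runs for each candidate block length `1, …, B'`. [cite: Simon1997, §3.1] -/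
def NB : ℕ := B' * M

/-- The block length of block `β`: candidate `β / M + 1`. [folklore] -/
def len (β : ℕ) : ℕ := β / M + 1

/-- The number of ancilla wires. [folklore] -/
def anc : ℕ := Wtot n B' (NB B' M) - n

/-- The number of wires, presented as input plus ancillas (`= Wtot`, `W_eq`). [folklore] -/
def W : ℕ := n + anc n B' M

/-- The number of `y`-qubits: the total length of the blocks. [folklore] -/
def Y : ℕ := ∑ β : Fin (NB B' M), len M β

variable {n B' M}

/-- Block lengths are at most `B'`. [folklore] -/
theorem len_le {β : ℕ} (hβ : β < NB B' M) : len M β ≤ B' := by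
  unfold len NB at *
  rcases Nat.eq_zero_or_pos M with rfl | hM
  · simp at hβ
  · have : β / M < B' := (Nat.div_lt_iff_lt_mul hM).2 hβ
    omega

/-- The input wires are among the `Wtot` wires. [folklore] -/
theorem n_le_Wtot (n B' NB : ℕ) : n ≤ Wtot n B' NB := by
  unfold Wtot topZ blkW baseR; nlinarith [Nat.zero_le (NB * (3 * B'))]

/-- `W = Wtot`. [folklore] -/
theorem W_eq : W n B' M = Wtot n B' (NB B' M) := by
  have := n_le_Wtot n B' (NB B' M); unfold W anc; omega

/-- There is at least one wire. [folklore] -/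
theorem W_pos : 0 < W n B' M := by rw [W_eq]; unfold Wtot; omega

variable (n B' M) in
/-- Wire `p` as an element of `Fin W` (meaningful for `p < W`). [folklore] -/
def foW (p : ℕ) : Fin (W n B' M) := finOf (W n B' M) W_pos p

/-- The value of `foW p` for `p < W`. [folklore] -/
theorem val_foW {p : ℕ} (hp : p < W n B' M) : (foW n B' M p : ℕ) = p := val_finOf_of_lt _ hp

/-- `foW` is injective below `W`. [folklore] -/
theorem foW_inj {p q : ℕ} (hp : p < W n B' M) (hq : q < W n B' M) (h : foW n B' M p = foW n B' M q) : p = q := by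
  have := congrArg Fin.val h
  rwa [val_foW hp, val_foW hq] at this

/-- An increasing list of wires below `W`, followed by a further wire below `W` not among them,
has no repetition after transport to `Fin W`. [folklore] -/
theorem nodup_map_foW_append {l : List ℕ} {t : ℕ} (hl : l.Pairwise (· < ·)) (ht : t ∉ l)
    (hlW : ∀ a ∈ l, a < W n B' M) (htW : t < W n B' M) : (l.map (foW n B' M) ++ [foW n B' M t]).Nodup := by
  rw [List.nodup_append]
  have hnd : l.Nodup := hl.imp fun h => Nat.ne_of_lt h
  refine ⟨hnd.map_on fun a ha b hb h => foW_inj (hlW a ha) (hlW b hb) h, List.nodup_singleton _, ?_⟩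
  intro a ha b hb
  rw [List.mem_singleton] at hb
  subst hb
  obtain ⟨a', ha', rfl⟩ := List.mem_map.1 ha
  exact fun h => ht (foW_inj (hlW a' ha') htW h ▸ ha')

/-- The block of `y`-qubit `k`. [folklore] -/
def blkOf (k : Fin (Y B' M)) : Fin (NB B' M) := (finSigmaFinEquiv.symm k).1

/-- The position of `y`-qubit `k` in its block. [folklore] -/
def posOf (k : Fin (Y B' M)) : ℕ := ((finSigmaFinEquiv.symm k).2 : ℕ)

/-- Positions are below the block length. [folklore] -/
theorem posOf_lt (k : Fin (Y B' M)) : posOf k < len M (blkOf k) := ((finSigmaFinEquiv.symm k).2).isLt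

/-- Positions are below `B'`. [folklore] -/
theorem posOf_lt_B' (k : Fin (Y B' M)) : posOf k < B' := lt_of_lt_of_le (posOf_lt k) (len_le (blkOf k).isLt)

/-- A `y`-qubit is determined by its block and position. [folklore] -/
theorem eq_of_blkOf_posOf {k k' : Fin (Y B' M)} (h1 : blkOf k = blkOf k') (h2 : posOf k = posOf k') : k = k' := by
  apply finSigmaFinEquiv.symm.injective
  unfold blkOf at h1
  unfold posOf at h2
  rcases hk : finSigmaFinEquiv.symm k with ⟨β, t⟩
  rcases hk' : finSigmaFinEquiv.symm k' with ⟨β', t'⟩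
  rw [hk, hk'] at h1 h2
  simp only at h1 h2
  subst h1
  simp only [Sigma.mk.injEq, heq_eq_eq, true_and]
  exact Fin.ext h2

/-- The `y`-qubit of block `β`, position `t < len β`. [folklore] -/
def yIdx (β : Fin (NB B' M)) (t : Fin (len M β)) : Fin (Y B' M) := finSigmaFinEquiv ⟨β, t⟩

/-- The block of `yIdx β t` is `β`. [folklore] -/
@[simp] theorem blkOf_yIdx (β : Fin (NB B' M)) (t : Fin (len M β)) : blkOf (yIdx β t) = β := by
  rw [blkOf, yIdx, Equiv.symm_apply_apply]

/-- The position of `yIdx β t` is `t`. [folklore] -/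
@[simp] theorem posOf_yIdx (β : Fin (NB B' M)) (t : Fin (len M β)) : posOf (yIdx β t) = t := by
  rw [posOf, yIdx, Equiv.symm_apply_apply]

/-- Pair wires lie below `W`. [folklore] -/
theorem pairW_lt_W (k : Fin (Y B' M)) {r : ℕ} (hr : r < 2) : pairW n B' (blkOf k) (posOf k) r < W n B' M :=
  (pairW_lt_topZ (blkOf k).isLt (posOf_lt_B' k) hr).trans (by rw [W_eq]; unfold Wtot; omega)

/-- Value wires lie below `W`. [folklore] -/
theorem valW_lt_W (k : Fin (Y B' M)) : valW n B' (blkOf k) (posOf k) < W n B' M :=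
  (valW_lt_topZ (blkOf k).isLt (posOf_lt_B' k)).trans (by rw [W_eq]; unfold Wtot; omega)

variable (n) in
/-- **The embedding of the pair register** `r` (`0 = y`, `1 = y'`) of all blocks into the wires. [folklore] -/
def pairEmb (r : ℕ) (hr : r < 2) : Fin (Y B' M) ↪ Fin (W n B' M) :=
  ⟨fun k => foW n B' M (pairW n B' (blkOf k) (posOf k) r), fun k k' h => by
    have h' := foW_inj (pairW_lt_W k hr) (pairW_lt_W k' hr) h
    obtain ⟨h1, h2, -⟩ := pairW_inj (posOf_lt_B' k) (posOf_lt_B' k') hr hr h'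
    exact eq_of_blkOf_posOf (Fin.ext h1) h2⟩

variable (n B' M) in
/-- The `y`-register wires. [folklore] -/
def eY : Fin (Y B' M) ↪ Fin (W n B' M) := pairEmb n 0 (by norm_num)

variable (n B' M) in
/-- The copy-register wires. [folklore] -/
def eY' : Fin (Y B' M) ↪ Fin (W n B' M) := pairEmb n 1 (by norm_num)

variable (n B' M) in
/-- **The embedding of the value register** of all blocks into the wires. [folklore] -/
def eV : Fin (Y B' M) ↪ Fin (W n B' M) :=
  ⟨fun k => foW n B' M (valW n B' (blkOf k) (posOf k)), fun k k' h => by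
    have h' := foW_inj (valW_lt_W k) (valW_lt_W k') h
    obtain ⟨h1, h2⟩ := valW_inj (posOf_lt_B' k) (posOf_lt_B' k') h'
    exact eq_of_blkOf_posOf (Fin.ext h1) h2⟩

/-- The value of a `y`-wire. [folklore] -/
theorem val_eY (k : Fin (Y B' M)) : (eY n B' M k : ℕ) = pairW n B' (blkOf k) (posOf k) 0 :=
  val_foW (pairW_lt_W k (by norm_num))

/-- The value of a copy wire. [folklore] -/
theorem val_eY' (k : Fin (Y B' M)) : (eY' n B' M k : ℕ) = pairW n B' (blkOf k) (posOf k) 1 :=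
  val_foW (pairW_lt_W k (by norm_num))

/-- The value of a value wire. [folklore] -/
theorem val_eV (k : Fin (Y B' M)) : (eV n B' M k : ℕ) = valW n B' (blkOf k) (posOf k) := val_foW (valW_lt_W k)

/-- `y`-wires and copy wires differ. [folklore] -/
theorem eY_ne_eY' (k k' : Fin (Y B' M)) : eY n B' M k ≠ eY' n B' M k' := fun h => by
  have h' := congrArg Fin.val h
  rw [val_eY, val_eY'] at h'
  exact absurd (pairW_inj (posOf_lt_B' k) (posOf_lt_B' k') (by norm_num) (by norm_num) h').2.2 (by norm_num)

/-- `y`-wires and value wires differ. [folklore] -/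
theorem eY_ne_eV (k k' : Fin (Y B' M)) : eY n B' M k ≠ eV n B' M k' := fun h => by
  have h' := congrArg Fin.val h
  rw [val_eY, val_eV] at h'
  exact pairW_ne_valW (posOf_lt_B' k) (by norm_num) (posOf_lt_B' k') h'

/-- Copy wires and value wires differ. [folklore] -/
theorem eY'_ne_eV (k k' : Fin (Y B' M)) : eY' n B' M k ≠ eV n B' M k' := fun h => by
  have h' := congrArg Fin.val h
  rw [val_eY', val_eV] at h'
  exact pairW_ne_valW (posOf_lt_B' k) (by norm_num) (posOf_lt_B' k') h'

end Params

/-! ### The programs -/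

section Ops

variable (n B' M : ℕ)

/-- The constant wires to set: the low wires except the zero at `p = 2n`, and the high wires. [folklore] -/
def constWires : List (Fin (W n B' M)) :=
  (((List.range (2 * n + 3)).filter fun p => p ≠ 2 * n).map (loW n) ++ (List.range (B' + 1)).map (hiW n B' (NB B' M))).map
    (foW n B' M)

/-- Set the constant wires (`NOT` gates). [folklore] -/
def notOps : List (RtOp (Fin (W n B' M))) := (constWires n B' M).map fun a => RtOp.cl (ClOp.not a)

/-- Query every announcement string `ancStr n i`, `i ≤ B'`, into its answer wire.
[cite: AaronsonChen2017, Thm. 7.6 (proof, p. 30)] -/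
def ancOps : List (RtOp (Fin (W n B' M))) :=
  (List.finRange (B' + 1)).map fun i : Fin (B' + 1) =>
    RtOp.oracle ((ancWires n B' (NB B' M) (i : ℕ)).map (foW n B' M)) (foW n B' M (cW n (i : ℕ)))

/-- The classical prefix. [folklore] -/
def preOps : List (RtOp (Fin (W n B' M))) := notOps n B' M ++ ancOps n B' M

/-- Copy the `y`-registers onto the copy registers (`CNOT`s). [cite: NielsenChuang2010, §1.3.1] -/
def copyOps : List (RtOp (Fin (W n B' M))) :=
  (List.finRange (Y B' M)).map fun k => RtOp.cl (ClOp.cnot (eY n B' M k) (eY' n B' M k))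

variable {B' M} in
/-- The query wires of value query `k` (block `blkOf k`, block length `len (blkOf k)`, bit `posOf k`). [folklore] -/
def qsOf (k : Fin (Y B' M)) : List (Fin (W n B' M)) :=
  (qryWires n B' (NB B' M) (blkOf k) (len M (blkOf k)) (posOf k)).map (foW n B' M)

/-- Query every value string `qryStr n y_β i'` into the value wire `w_{β,i'}`. [cite: Simon1997, §3.1] -/
def qryOps : List (RtOp (Fin (W n B' M))) :=
  (List.finRange (Y B' M)).map fun k => RtOp.oracle (qsOf n k) (eV n B' M k)

/-- The middle segment: copy, query, uncopy. [cite: Simon1997, §3.1] -/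
def midOps : List (RtOp (Fin (W n B' M))) := copyOps n B' M ++ (qryOps n B' M ++ copyOps n B' M)

variable {n B' M}

/-- The prefix is well formed. [folklore] -/
theorem preOps_wf : ∀ op ∈ preOps n B' M, op.WF := by
  intro op hop
  rcases List.mem_append.1 hop with h | h
  · obtain ⟨a, -, rfl⟩ := List.mem_map.1 h
    trivial
  · obtain ⟨i, -, rfl⟩ := List.mem_map.1 h
    have hi : (i : ℕ) ≤ B' := Nat.lt_succ_iff.1 i.isLt
    exact nodup_map_foW_append pairwise_lt_ancWires (cW_not_mem_ancWires hi)
      (fun a ha => W_eq (n := n) (B' := B') (M := M) ▸ lt_Wtot_of_mem_ancWires hi ha) (by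
        have := cW_lt_blkW (n := n) (B' := B') hi (NB B' M)
        rw [W_eq]; unfold Wtot topZ; omega)

/-- The prefix is classical-or-oracle. [folklore] -/
theorem preOps_isCO : ∀ op ∈ preOps n B' M, op.IsCO := by
  intro op hop
  rcases List.mem_append.1 hop with h | h
  · obtain ⟨a, -, rfl⟩ := List.mem_map.1 h; trivial
  · obtain ⟨i, -, rfl⟩ := List.mem_map.1 h; trivial

/-- The copies are well formed. [folklore] -/
theorem copyOps_wf : ∀ op ∈ copyOps n B' M, op.WF := by
  intro op hop
  obtain ⟨k, -, rfl⟩ := List.mem_map.1 hop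
  exact eY_ne_eY' k k

/-- The queries are well formed. [folklore] -/
theorem qryOps_wf : ∀ op ∈ qryOps n B' M, op.WF := by
  intro op hop
  obtain ⟨k, -, rfl⟩ := List.mem_map.1 hop
  show ((qryWires n B' (NB B' M) (blkOf k) (len M (blkOf k)) (posOf k)).map (foW n B' M) ++
    [foW n B' M (valW n B' (blkOf k) (posOf k))]).Nodup
  exact nodup_map_foW_append (pairwise_lt_qryWires (blkOf k).isLt (len_le (blkOf k).isLt))
    (valW_not_mem_qryWires (blkOf k).isLt (len_le (blkOf k).isLt) (posOf_lt_B' k))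
    (fun a ha => W_eq (n := n) (B' := B') (M := M) ▸
      lt_Wtot_of_mem_qryWires (blkOf k).isLt (len_le (blkOf k).isLt) (posOf_lt_B' k).le ha) (valW_lt_W k)

/-- The middle segment is well formed. [folklore] -/
theorem midOps_wf : ∀ op ∈ midOps n B' M, op.WF := by
  intro op hop
  rcases List.mem_append.1 hop with h | h
  · exact copyOps_wf op h
  · rcases List.mem_append.1 h with h | h
    · exact qryOps_wf op h
    · exact copyOps_wf op h

/-- The middle segment is classical-or-oracle. [folklore] -/
theorem midOps_isCO : ∀ op ∈ midOps n B' M, op.IsCO := by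
  intro op hop
  rcases List.mem_append.1 hop with h | h
  · obtain ⟨k, -, rfl⟩ := List.mem_map.1 h; trivial
  · rcases List.mem_append.1 h with h | h
    · obtain ⟨k, -, rfl⟩ := List.mem_map.1 h; trivial
    · obtain ⟨k, -, rfl⟩ := List.mem_map.1 h; trivial

variable (n B' M) in
/-- **The Simon sampler circuit**: prefix, then the `H–mid–H` sandwich on the `y`-registers.
[cite: Simon1997, §3.1] [cite: ServedioGortler2004, §6] -/
def samplerGates : List (QGate cliffordT (W n B' M)) :=
  RtOp.compileList (preOps n B' M) preOps_wf ++
    (hLayerE (eY n B' M) ++ (RtOp.compileList (midOps n B' M) midOps_wf ++ hLayerE (eY n B' M)))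

/-- The number of gates: at most `24` per operation plus two Hadamard layers. [folklore] -/
theorem length_samplerGates_le :
    (samplerGates n B' M).length ≤ 24 * ((preOps n B' M).length + (midOps n B' M).length) + 2 * Y B' M := by
  unfold samplerGates
  simp only [List.length_append, hLayerE, List.length_map, List.length_finRange]
  have h1 := RtOp.length_compileList_le (preOps n B' M) preOps_wf
  have h2 := RtOp.length_compileList_le (midOps n B' M) midOps_wf
  omega

end Ops

end SimonOracle

end Literature.Computability.QuantumComplexity

end
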